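import Summits.Ventures.PercRepro0.Trif

/-!
# Trifurcations in a box: Lemma 3.6 and `δ = 0` (UNIQUENESS-p6-v1 §3.6, §4 Step 3(b)), seat p6

Kernel-checked twin, on `Defs.lean`, of the counting half of Step 3 of the uniqueness proof
(objects in `Trif.lean`):

* Lemma 3.6 = `card_trifFinset_le`: for every configuration, the trifurcations in `Λ_n` number at most
  `|∂Λ_{n+1}|` (per connected component of the open graph, `Trif.card_add_two_le_of_mutual` with
  `Y` = the component's vertices on `∂Λ_{n+1}`: every branch of a trifurcation reaches `∂Λ_{n+1}`
  avoiding it, and a walk avoiding the trifurcation joining two such boundary vertices would join two of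
  its branches in `ω^{(v)}`);
* Step 3(b) = `P_isTrif_zero_eq_zero`: `E_p|R_n| = Σ_{x ∈ Λ_n} P_p(x is a trifurcation) = (2n+1)^d δ`
  (translation invariance, `Trif.P_isTrif_eq`) is at most `(2n+3)^d − (2n+1)^d` for every `n`, hence
  `δ = P_p(0 is a trifurcation) = 0` (the ratio tends to `0`).
-/

namespace Summit.Ventures.PercRepro0.TrifCount

open MeasureTheory ProbabilityTheory unitInterval Set Function Filter Topology
open scoped ENNReal
open Summit.Ventures.PercRepro0.Defs
open Summit.Ventures.PercRepro0.Merge (mem_box_succ_of_adj)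
open Summit.Ventures.PercRepro0.Trif

variable {d : ℕ}

/-! ## Lemma 3.6: trifurcations in a box -/

/-- A walk of any configuration from a vertex of `Λ_n` to a vertex outside `Λ_n` passes through `∂Λ_{n+1}`:
some vertex of `Λ_{n+1} ∖ Λ_n` is reachable from the start. -/
theorem exists_bdry_of_walk {ω : Config d} {n : ℕ} :
    ∀ {a b : Vertex d}, (openGraph d ω).Walk a b → a ∈ box d n → b ∉ box d n →
      ∃ y, y ∈ box d (n + 1) ∧ y ∉ box d n ∧ Conn d ω a y := by
  intro a b p
  induction p with
  | nil => intro ha hb; exact absurd ha hb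
  | @cons u v w hadj p ih =>
    intro hu hw
    have hlat : (lattice d).Adj u v := by
      rw [openGraph, SimpleGraph.fromEdgeSet_adj] at hadj
      exact hadj.1.2
    by_cases hv : v ∈ box d n
    · obtain ⟨y, hy1, hy2, hy3⟩ := ih hv hw
      exact ⟨y, hy1, hy2, hadj.reachable.trans hy3⟩
    · exact ⟨v, mem_box_succ_of_adj hlat hu, hv, hadj.reachable⟩

/-- Every branch of a trifurcation `v ∈ Λ_n` reaches `∂Λ_{n+1}` avoiding `v`: for an open bond `{v, w}`
with `w` in an infinite cluster of `ω^{(v)}`, some `y ∈ ∂Λ_{n+1}` is joined to `w` in `ω^{(v)}`. -/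
theorem exists_bdry_branch {ω : Config d} {n : ℕ} {v w : Vertex d} (hv : v ∈ box d n)
    (hvw : s(v, w) ∈ bonds d) (hinf : ConnInf d (closeAt ω v) w) :
    ∃ y ∈ bdryFinset d n, Conn d (closeAt ω v) w y := by
  have hw : w ∈ box d (n + 1) := mem_box_succ_of_adj hvw hv
  by_cases hwn : w ∈ box d n
  · obtain ⟨y', hy', hconn⟩ := (connInf_iff _ _).1 hinf n
    obtain ⟨p⟩ := hconn
    obtain ⟨y, hy1, hy2, hy3⟩ := exists_bdry_of_walk p hwn hy'
    exact ⟨y, mem_bdryFinset.2 ⟨hy1, hy2⟩, hy3⟩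
  · exact ⟨w, mem_bdryFinset.2 ⟨hw, hwn⟩, SimpleGraph.Reachable.refl _⟩

/-- A walk of `ω` avoiding `v` is a walk of `ω^{(v)}`. -/
theorem conn_closeAt_of_walk {ω : Config d} {v a b : Vertex d} (p : (openGraph d ω).Walk a b)
    (hp : v ∉ p.support) : Conn d (closeAt ω v) a b := by
  refine ⟨p.transfer (openGraph d (closeAt ω v)) fun e he => ?_⟩
  have hE := SimpleGraph.Walk.edges_subset_edgeSet p he
  rw [openGraph, SimpleGraph.edgeSet_fromEdgeSet] at hE ⊢
  refine ⟨⟨⟨hE.1.1, ?_⟩, hE.1.2⟩, hE.2⟩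
  intro hve
  induction e using Sym2.ind with
  | h x y =>
    rw [Set.mem_setOf_eq, Sym2.mem_iff] at hve
    rcases hve with rfl | rfl
    · exact hp (SimpleGraph.Walk.fst_mem_support_of_mem_edges p he)
    · exact hp (SimpleGraph.Walk.snd_mem_support_of_mem_edges p he)

/-- Lemma 3.6: for every configuration, the trifurcations in `Λ_n` number at most `|∂Λ_{n+1}|`. -/
theorem card_trifFinset_le (ω : Config d) (n : ℕ) : (trifFinset ω n).card ≤ (bdryFinset d n).card := by
  classical
  set R := trifFinset ω n with hRdef
  set Bd := bdryFinset d n with hBddef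
  set K := openGraph d ω with hKdef
  let c : Vertex d → K.ConnectedComponent := K.connectedComponentMk
  -- per component: Lemma 3.5
  have hcomp : ∀ C ∈ R.image c,
      (R.filter fun x => c x = C).card + 2 ≤ (Bd.filter fun y => c y = C).card := by
    intro C hC
    obtain ⟨x₀, hx₀, rfl⟩ := Finset.mem_image.1 hC
    refine card_add_two_le_of_mutual K {b | c b = c x₀} ?_ ?_ _ _ ?_ ?_ ⟨x₀, ?_⟩ ?_ ?_
    · intro a ha b hab
      exact (SimpleGraph.ConnectedComponent.sound hab).symm.trans ha
    · intro a ha b hb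
      exact SimpleGraph.ConnectedComponent.exact (ha.trans hb.symm)
    · intro x hx
      exact (Finset.mem_filter.1 hx).2
    · intro y hy
      exact (Finset.mem_filter.1 hy).2
    · exact Finset.mem_filter.2 ⟨hx₀, rfl⟩
    · rw [Finset.disjoint_left]
      intro x hx hx'
      have h1 := (mem_trifFinset.1 (Finset.mem_filter.1 hx).1).1
      have h2 := (mem_bdryFinset.1 (Finset.mem_filter.1 hx').1).2
      exact h2 h1
    · intro v hv
      obtain ⟨hvR, hvc⟩ := Finset.mem_filter.1 hv
      obtain ⟨hvbox, w, hw, hinf, hsep⟩ := mem_trifFinset.1 hvR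
      -- the three boundary vertices
      have hy : ∀ i, ∃ y ∈ Bd, Conn d (closeAt ω v) (w i) y :=
        fun i => exists_bdry_branch hvbox (hw i).2 (hinf i)
      choose y hyB hyc using hy
      have hyC : ∀ i, y i ∈ Bd.filter fun y => c y = c x₀ := by
        intro i
        refine Finset.mem_filter.2 ⟨hyB i, ?_⟩
        rw [← hvc]
        refine (SimpleGraph.ConnectedComponent.sound ?_).symm
        have h1 : K.Reachable v (w i) := by
          refine SimpleGraph.Adj.reachable ?_
          rw [hKdef, openGraph, SimpleGraph.fromEdgeSet_adj]
          exact ⟨⟨(hw i).1, (hw i).2⟩, (lattice d).ne_of_adj (hw i).2⟩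
        exact h1.trans (conn_mono (closeAt_subset ω v) (hyc i))
      -- separation: a walk of `ω` from `y i` to `y j` avoiding `v` would join `w i` to `w j` in `ω^{(v)}`
      have hsep' : ∀ i j, i ≠ j → ¬ ∃ p : K.Walk (y i) (y j), v ∉ p.support := by
        rintro i j hij ⟨p, hp⟩
        exact hsep i j hij ((hyc i).trans ((conn_closeAt_of_walk p hp).trans (hyc j).symm))
      exact ⟨y 0, hyC 0, y 1, hyC 1, y 2, hyC 2, hsep' 0 1 (by decide), hsep' 0 2 (by decide),
        hsep' 1 2 (by decide)⟩
  -- the components of the trifurcations are components of boundary vertices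
  have himg : R.image c ⊆ Bd.image c := by
    intro C hC
    have h := hcomp C hC
    obtain ⟨y, hy⟩ : (Bd.filter fun y => c y = C).Nonempty := by
      rw [← Finset.card_pos]
      omega
    exact Finset.mem_image.2 ⟨y, (Finset.mem_filter.1 hy).1, (Finset.mem_filter.1 hy).2⟩
  calc R.card = ∑ C ∈ R.image c, (R.filter fun x => c x = C).card :=
        Finset.card_eq_sum_card_image c R
    _ ≤ ∑ C ∈ R.image c, (Bd.filter fun y => c y = C).card :=
        Finset.sum_le_sum fun C hC => by have := hcomp C hC; omega
    _ ≤ ∑ C ∈ Bd.image c, (Bd.filter fun y => c y = C).card :=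
        Finset.sum_le_sum_of_subset himg
    _ = Bd.card := (Finset.card_eq_sum_card_image c Bd).symm

/-! ## Step 3(b): the expected number of trifurcations, and `δ = 0` -/

/-- `|R_n(ω)|` as a sum of indicators over `Λ_n`. -/
theorem card_trifFinset_eq_sum (ω : Config d) (n : ℕ) :
    ((trifFinset ω n).card : ℝ≥0∞) =
      ∑ x ∈ boxFinset d n, ({ω' : Config d | IsTrif ω' x}).indicator 1 ω := by
  classical
  rw [trifFinset, Finset.card_filter]
  push_cast
  refine Finset.sum_congr rfl fun x _ => ?_
  by_cases h : IsTrif ω x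
  · rw [if_pos h, Set.indicator_of_mem (show ω ∈ {ω' : Config d | IsTrif ω' x} from h)]
    rfl
  · rw [if_neg h, Set.indicator_of_notMem (show ω ∉ {ω' : Config d | IsTrif ω' x} from h)]

/-- `E_p|R_n| = Σ_{x ∈ Λ_n} P_p(x is a trifurcation) ≤ |∂Λ_{n+1}|` (Lemma 3.6 under the expectation). -/
theorem sum_P_isTrif_le (p : I) (n : ℕ) :
    ∑ x ∈ boxFinset d n, P d p {ω : Config d | IsTrif ω x} ≤ ((bdryFinset d n).card : ℝ≥0∞) := by
  classical
  calc ∑ x ∈ boxFinset d n, P d p {ω : Config d | IsTrif ω x}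
      = ∑ x ∈ boxFinset d n, ∫⁻ ω, ({ω' : Config d | IsTrif ω' x}).indicator 1 ω ∂(P d p) := by
        refine Finset.sum_congr rfl fun x _ => ?_
        rw [lintegral_indicator_one (measurableSet_isTrif x)]
    _ = ∫⁻ ω, ∑ x ∈ boxFinset d n, ({ω' : Config d | IsTrif ω' x}).indicator 1 ω ∂(P d p) :=
        (lintegral_finsetSum _ fun x _ => measurable_const.indicator (measurableSet_isTrif x)).symm
    _ ≤ ∫⁻ _, ((bdryFinset d n).card : ℝ≥0∞) ∂(P d p) := by
        refine lintegral_mono fun ω => ?_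
        rw [← card_trifFinset_eq_sum]
        exact Nat.mono_cast (card_trifFinset_le ω n)
    _ = ((bdryFinset d n).card : ℝ≥0∞) := by rw [lintegral_const, measure_univ, mul_one]

/-- `(2n+3)/(2n+1))^d − 1 → 0`. -/
theorem tendsto_ratio_pow_sub_one (d : ℕ) :
    Tendsto (fun n : ℕ => ((2 * n + 3) / (2 * n + 1) : ℝ) ^ d - 1) atTop (𝓝 0) := by
  have h1 : Tendsto (fun n : ℕ => (2 * (n : ℝ) + 1)) atTop atTop :=
    (tendsto_natCast_atTop_atTop.const_mul_atTop two_pos).atTop_add tendsto_const_nhds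
  have h2 : Tendsto (fun n : ℕ => (2 : ℝ) / (2 * (n : ℝ) + 1)) atTop (𝓝 0) :=
    tendsto_const_nhds.div_atTop h1
  have h3 : Tendsto (fun n : ℕ => (1 + (2 : ℝ) / (2 * (n : ℝ) + 1)) ^ d - 1) atTop (𝓝 ((1 + 0) ^ d - 1)) :=
    ((tendsto_const_nhds.add h2).pow d).sub_const 1
  rw [add_zero, one_pow, sub_self] at h3
  refine h3.congr fun n => ?_
  have hpos : (2 * (n : ℝ) + 1) ≠ 0 := by positivity
  congr 2
  field_simp
  ring

/-- Step 3(b): `δ = P_p(0 is a trifurcation) = 0`: `(2n+1)^d δ ≤ (2n+3)^d − (2n+1)^d` for every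
`n`, and the right side is `o((2n+1)^d)`. -/
theorem P_isTrif_zero_eq_zero (p : I) : P d p {ω : Config d | IsTrif ω 0} = 0 := by
  set δ : ℝ≥0∞ := P d p {ω : Config d | IsTrif ω 0} with hδ
  have key : ∀ n : ℕ, (((2 * n + 1) ^ d : ℕ) : ℝ≥0∞) * δ ≤ (((2 * n + 3) ^ d - (2 * n + 1) ^ d : ℕ) : ℝ≥0∞) := by
    intro n
    have h := sum_P_isTrif_le (d := d) p n
    rw [card_bdryFinset] at h
    simp only [P_isTrif_eq p, Finset.sum_const, card_boxFinset, nsmul_eq_mul] at h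
    exact_mod_cast h
  set δr : ℝ := δ.toReal with hδr
  have hpow : ∀ n : ℕ, (2 * n + 1) ^ d ≤ (2 * n + 3) ^ d := fun n => Nat.pow_le_pow_left (by omega) d
  have keyr : ∀ n : ℕ, δr ≤ ((2 * n + 3) / (2 * n + 1) : ℝ) ^ d - 1 := by
    intro n
    have h := ENNReal.toReal_mono (by finiteness) (key n)
    rw [ENNReal.toReal_mul, ENNReal.toReal_natCast, ENNReal.toReal_natCast, Nat.cast_sub (hpow n)] at h
    push_cast at h
    have hapos : (0 : ℝ) < (2 * n + 1) ^ d := by positivity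
    rw [div_pow, le_sub_iff_add_le, le_div_iff₀ hapos, add_mul, one_mul]
    have h' : δr * (2 * n + 1) ^ d ≤ (2 * n + 3) ^ d - (2 * n + 1) ^ d := by
      rw [mul_comm]
      exact h
    linarith
  have hlim := tendsto_ratio_pow_sub_one d
  have hle : δr ≤ 0 := le_of_tendsto_of_tendsto' tendsto_const_nhds hlim keyr
  have hδr0 : δr = 0 := le_antisymm hle ENNReal.toReal_nonneg
  rw [hδr, ENNReal.toReal_eq_zero_iff] at hδr0
  exact hδr0.resolve_right (measure_ne_top _ _)

/-- Step 3(b) at every vertex: `P_p(x is a trifurcation) = 0` for every `x` (translation invariance). -/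
theorem P_isTrif_eq_zero (p : I) (x : Vertex d) : P d p {ω : Config d | IsTrif ω x} = 0 := by
  rw [P_isTrif_eq p x]
  exact P_isTrif_zero_eq_zero p

/-- Almost surely there is no trifurcation anywhere (countable union over the vertices). -/
theorem P_exists_isTrif_eq_zero (p : I) : P d p {ω : Config d | ∃ x, IsTrif ω x} = 0 := by
  have : {ω : Config d | ∃ x, IsTrif ω x} = ⋃ x, {ω : Config d | IsTrif ω x} := by
    ext ω
    simp only [Set.mem_setOf_eq, Set.mem_iUnion]
  rw [this]
  exact measure_iUnion_null fun x => P_isTrif_eq_zero p x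

end Summit.Ventures.PercRepro0.TrifCount
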